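import Literature.AnabelianGeometry.SemiGraphs.ArithThm54iiiUmbrellaOfChartDict
import Literature.AnabelianGeometry.SemiGraphs.ArithIotaOfChartDictOuterModel
import Literature.AnabelianGeometry.SemiGraphs.ArithTemperedGroupOfOuterAction
import Literature.AnabelianGeometry.SemiGraphs.ArithChartBranchActionOuter
import Literature.AnabelianGeometry.SemiGraphs.ArithThm54OfBranchAction
import HarnessLib

/-!
# [SemiAnbd] Thm 5.4 (iii), COMPATIBLE reading, AT THE OUTER MODELS `π₁^temp(𝔾) ⋊^out Π_A`,
# `π₁^temp(ℍ′) ⋊^out Π_{A′}` — the junction-v5 umbrella with the structural producers bound by name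
# (corollary-integrator, (iii) v1; proof-only)

Mochizuki, *Semi-graphs of anabelioids*, Publ. RIMS **42** (2006) 221–322, §0 p. 5 (`G ⋊^out J`), §5 Def 5.1 (i)
p. 62, Prop 5.2 (iv) p. 64 ("natural exact sequences `1 → Π^temp_𝒢 → Π^temp_𝔊 → Π_A → 1`"), Def 5.3 p. 65,
Thm 5.4 (iii) p. 66 [cite: MochizukiSemiAnbd2006, Thm 5.4 (iii), p. 66].

PROOF-ONLY file (abc-iut cell, layer L3, sub-DAG `plan/L3/SUBDAG-SemiAnbd-Thm54.md`; row «T54·COROLLARY-INTEGRATOR»,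
corollary (iii) per the L3 lead's α81/α85 «binds p436919»; seat abc-iut-w4-d089 gen 6).  No definition, no new
named fact, no producer restated.  abc-iut-w5-d141's junction v5
`arithQuasiGeometricCorrespondenceStatementCompat_ofChartDict` (ArithThm54iiiUmbrellaOfChartDict.lean, p436919) is
[SemiAnbd] Thm 5.4 (iii) (compatible reading, abc-iut-w4-d083's `ArithQuasiGeometricCorrespondenceStatementCompat`)
at the PRODUCED decomposition data over two tempered charts `c𝒢`, `cℋ`, for ABSTRACT arithmetic tempered groups
`Gtp ⊇ ι_𝔾(π₁^temp 𝔾)`, `Htp ⊇ ι_ℍ(π₁^temp ℍ′)` with augmentations to `Π_A`, `Π_{A′}` (`e : Π_A ≅ Π_{A′}`).  Here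
both are INSTANTIATED at the cell's algebraic model of Prop 5.2 (iv) (abc-iut-w4-d082 / abc-iut-L3-d2,
ArithTemperedGroupOfOuterAction.lean): `Gtp := π₁^temp(𝔾) ⋊^out_{ρ_𝔾} Π_A`, `Htp := π₁^temp(ℍ′) ⋊^out_{ρ_ℍ} Π_{A′}`
along outer actions `ρ_𝔾 : Π_A → Out π₁^temp(𝔾)`, `ρ_ℍ : Π_{A′} → Out π₁^temp(ℍ′)` over base actions on the
underlying semi-graphs, with `ι := toOuterSemidirectProduct`, `aug := outerSemidirectProductSnd` — `ℍ′`'s model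
over ITS OWN arithmetic quotient `Π_{A′}` (print-faithful), the umbrella's `e⁻¹ ∘ aug_ℍ` currency being reached
by TRANSPORT ALONG `e` (first section: `IsArithAmple`, `IsArithMaximalCompact`, Thm 5.4 (ii)'s and Rmk 5.3.1's
statements and abc-iut-w4-d053's `ArithChartAction` are invariant under post-composition of the augmentation
with an isomorphism of topological groups).  BOUND BY NAME:

* `ι_𝔾`, `ι_ℍ` injective, `range ι = Ker aug`, `aug_𝔾` surjective := `outerAction_exact` (temp-slimness);
* the two `ArithChartAction`s := abc-iut-w4-d082's `arithChartAction_outerAction` from the Def 5.1 (i) design data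
  `hV hE hopen` / `hV′ hE′ hopen′` (Prop 3.6 (iv) at `ρ(a)` on verticial / edge-like subgroups, Def 5.1 (i)(c)),
  transported along `e` on the `ℍ′` side;
* `hact𝒢` / `hactℋ` («conjugation by `γ ∈ Π^temp_𝔊` on `ι(π₁^temp 𝔾)` represents `(F (aug γ))^*`») :=
  abc-iut-w5-d141's `hact_outerSemidirectProduct` (ArithIotaOfChartDictOuterModel.lean, p437103) from its
  representative data `hrep𝒢` / `hrepℋ` (Prop 3.6 (iv) at `ρ(a)` in chart-pull-back currency);
* Thm 3.7 (iii) at `𝔾` and at `ℍ′` := `compactInVerticialAt_of_finiteGraph'` (FINITE graphs of anabelioids —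
  the case [IUTchI] consumes; abc-iut-L3-t8 / abc-iut-w4-d064);
* the branch commensurators of p. 65 (`hcommB`, `hcommB′`: `C(Π^temp_{𝔊,b} ∩ Ker aug) = Π^temp_{𝔊,b}`) :=
  `ArithChartBranchAction.hcommB_At` (ArithThm54OfBranchAction.lean) over abc-iut-w4-d082's branch-granular
  `arithChartBranchAction_outerAction` (design datum `hBR`, Thm 5.4's frame `noSwitchBase`).

KEPT as binders ((iii) v1; each with its owner): the TOPOLOGY-dependent items of the two outer models — instance
binders `[TopologicalSpace Gtp]`, `[TopologicalSpace Htp] [IsTopologicalGroup Htp] [T2Space Htp]`, `ι_𝔾` continuous,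
`ι_ℍ` an embedding, `aug_ℍ` continuous (abc-iut-w6-d070's `arithLevelTopology` package supplies them — v2 pins the
topology exactly as `ArithThm54CapstonesChartLevelTopology.lean` does); Thm 5.4 (ii) and Rmk 5.3.1 at the two
outer models (`hIIG hIIH hRG hRH`, NATIVELY over `Π_A` resp. `Π_{A′}` — the conclusions of this seat's
`arithMaximalCompactStatement_outerAction_piPresentation_levelTopology_of_branchPair` /
`…_chart_of_producers_levelTopology` and of abc-iut-w4-d040's `verticialEdgeLikeCompactAmple_outerAction_cosetTowerC`);
and the umbrella's own design / dictionary binders VERBATIM (the arithmetic `B^temp`: `btemp hcont hover hbtempφ`;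
the dictionary (D1)/(D2): `dict θd hlo φc hφc hfaith hfull`; the graph actions with representatives:
`F𝒢 θ𝒢 hrep𝒢 hpre`, `Fℋ θℋ hrepℋ hpost` — `ℍ′`'s natively indexed by `Π_{A′}`; the Def 5.1 (i) design data
`hV hE hopen hBR` ×2 and Thm 5.4's frame `noSwitchBase` ×2 — SHARED with the (i)/(ii) board; the Cor 3.9 frames
`h𝒢 hℋ`; `e` continuous).  Nothing beyond composition and transport is proved
here; typed ≠ proved for the inputs; this is Thm 5.4 (iii) for OUR tower decompositions; no side taken on
[IUTchIII] Cor. 3.12.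
-/

namespace Literature.AnabelianGeometry.SemiGraphs

open _root_.CategoryTheory _root_.Topology ProfiniteSemiGraph Literature.AnabelianGeometry.EtaleTheta

/-! ### Transport of the §5 predicates along an isomorphism of the arithmetic quotient -/

section Transport

universe uG uP uQ uV uB

variable {Gtp : Type uG} [Group Gtp] [TopologicalSpace Gtp]
  {PA₁ : Type uP} [Group PA₁] [TopologicalSpace PA₁] {PA₂ : Type uQ} [Group PA₂] [TopologicalSpace PA₂]
  {V : Type uV} {B : Type uB}

omit [TopologicalSpace Gtp] in
/-- `IsArithAmple` ([SemiAnbd] Def 5.3 (i)) is invariant under post-composing the augmentation with an isomorphism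
of topological groups. [cite: MochizukiSemiAnbd2006, Def 5.3 (i), p. 65] -/
theorem isArithAmple_comp_mulEquiv_iff (e : PA₂ ≃* PA₁) (he : Continuous e) (he' : Continuous e.symm)
    (aug : Gtp →* PA₂) (K : Subgroup Gtp) :
    IsArithAmple (e.toMonoidHom.comp aug) K ↔ IsArithAmple aug K := by
  let eh : PA₂ ≃ₜ PA₁ := { e.toEquiv with continuous_toFun := he, continuous_invFun := he' }
  have hset : ((K.map (e.toMonoidHom.comp aug) : Subgroup PA₁) : Set PA₁) = eh '' (K.map aug : Set PA₂) := by
    rw [← Subgroup.map_map, Subgroup.coe_map]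
    rfl
  simp only [IsArithAmple]
  rw [hset, eh.isOpen_image]

/-- `IsArithMaximalCompact` ([SemiAnbd] Def 5.3 (i)) is invariant under post-composing the augmentation with an
isomorphism of topological groups. [cite: MochizukiSemiAnbd2006, Def 5.3 (i), p. 65] -/
theorem isArithMaximalCompact_comp_mulEquiv_iff (e : PA₂ ≃* PA₁) (he : Continuous e) (he' : Continuous e.symm)
    (aug : Gtp →* PA₂) (K : Subgroup Gtp) :
    IsArithMaximalCompact (e.toMonoidHom.comp aug) K ↔ IsArithMaximalCompact aug K := by
  simp only [IsArithMaximalCompact, isArithAmple_comp_mulEquiv_iff e he he']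

/-- Thm 5.4 (ii)'s statement ([SemiAnbd] p. 66) is invariant under post-composing the augmentation with an
isomorphism of topological groups. [cite: MochizukiSemiAnbd2006, Thm 5.4 (ii), p. 66] -/
theorem arithMaximalCompactStatementII_comp_mulEquiv_iff (e : PA₂ ≃* PA₁) (he : Continuous e)
    (he' : Continuous e.symm) (D : DecompositionData Gtp V B) (aug : Gtp →* PA₂) :
    ArithMaximalCompactStatementII D (e.toMonoidHom.comp aug) ↔ ArithMaximalCompactStatementII D aug := by
  simp only [ArithMaximalCompactStatementII, isArithMaximalCompact_comp_mulEquiv_iff e he he',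
    isArithAmple_comp_mulEquiv_iff e he he']

/-- Rmk 5.3.1's first sentence ([SemiAnbd] p. 65) is invariant under post-composing the augmentation with an
isomorphism of topological groups. [cite: MochizukiSemiAnbd2006, Rmk 5.3.1, p. 65] -/
theorem verticialEdgeLikeCompactAmpleStatement_comp_mulEquiv_iff (e : PA₂ ≃* PA₁) (he : Continuous e)
    (he' : Continuous e.symm) (D : DecompositionData Gtp V B) (aug : Gtp →* PA₂) :
    VerticialEdgeLikeCompactAmpleStatement D (e.toMonoidHom.comp aug) ↔
      VerticialEdgeLikeCompactAmpleStatement D aug := by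
  simp only [VerticialEdgeLikeCompactAmpleStatement, isArithAmple_comp_mulEquiv_iff e he he']

omit [TopologicalSpace Gtp] in
/-- abc-iut-w4-d053's `ArithChartAction` (Def 5.1 (i) on a chart) transports along an isomorphism of the
arithmetic quotient: re-index the actions on the underlying semi-graph through `e⁻¹`.
[cite: MochizukiSemiAnbd2006, Def 5.1 (i), p. 62] -/
theorem ProfiniteSemiGraph.ArithChartAction.comp_mulEquiv {𝒢 : ProfiniteSemiGraph} {c : TemperedPiChart 𝒢}
    {ι : c.G →* Gtp} {aug : Gtp →* PA₂}
    {actV : PA₂ → 𝒢.graph.Vertex → 𝒢.graph.Vertex} {actE : PA₂ → 𝒢.graph.Edge → 𝒢.graph.Edge}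
    {actB : PA₂ → 𝒢.graph.Branch → 𝒢.graph.Branch} (A : ArithChartAction c ι aug actV actE actB)
    (e : PA₂ ≃* PA₁) (he' : Continuous e.symm) :
    ArithChartAction c ι (e.toMonoidHom.comp aug) (fun a v => actV (e.symm a) v) (fun a x => actE (e.symm a) x)
      (fun a b => actB (e.symm a) b) where
  edgeOf_actB a b := A.edgeOf_actB (e.symm a) b
  abuts_actB a b v h := A.abuts_actB (e.symm a) b v h
  conj_verticial g v H hH := by
    simpa only [MonoidHom.coe_comp, Function.comp_apply, MulEquiv.coe_toMonoidHom, MulEquiv.symm_apply_apply]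
      using A.conj_verticial g v H hH
  conj_edgeLike g x K hK := by
    simpa only [MonoidHom.coe_comp, Function.comp_apply, MulEquiv.coe_toMonoidHom, MulEquiv.symm_apply_apply]
      using A.conj_edgeLike g x K hK
  exists_open_trivial := by
    obtain ⟨U, hUo, hU⟩ := A.exists_open_trivial
    exact ⟨U.comap e.symm.toMonoidHom, hUo.preimage he', fun a ha => hU (e.symm a) ha⟩

end Transport

/-! ### Thm 5.4 (iii) at the outer models -/

universe u v u₀

-- the arithmetic quotients `Π_A`, `Π_{A′}` live in the universe of the semi-graphs of anabelioids (the frame of the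
-- cell's outer-model line: abc-iut-w4-d029's capstones, abc-iut-w6-d070's topology, `hcommB_At`)
variable {Obj : Type u} [Category.{v} Obj] {𝓥 : SemiAnbdVocab.{u, v, u₀} Obj}
variable {𝔊 ℍ : ArithSemiGraph 𝓥} {e : 𝔊.PA ≃* ℍ.PA}
variable {𝒢 ℋ : ProfiniteSemiGraph.{u₀}} {c𝒢 : TemperedPiChart 𝒢} {cℋ : TemperedPiChart ℋ}

/-- **[SemiAnbd] Thm 5.4 (iii), compatible reading, AT THE OUTER MODELS** `Π^temp_𝔊 := π₁^temp(𝔾) ⋊^out_{ρ_𝔾} Π_A`,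
`Π^temp_ℍ := π₁^temp(ℍ′) ⋊^out_{ρ_ℍ} Π_{A′}` of Prop 5.2 (iv), for FINITE graphs of anabelioids `𝔾`, `ℍ′`:
abc-iut-w5-d141's junction v5 `arithQuasiGeometricCorrespondenceStatementCompat_ofChartDict` with `ι := toOuterSemidirectProduct`,
`aug := outerSemidirectProductSnd`, exactness := `outerAction_exact`, the two `ArithChartAction`s :=
`arithChartAction_outerAction` (transported along `e` on the `ℍ′` side), `hact` := `hact_outerSemidirectProduct`,
Thm 3.7 (iii) := `compactInVerticialAt_of_finiteGraph'`, `hcommB`/`hcommB′` := `ArithChartBranchAction.hcommB_At`.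
Residual binders: module docstring.
[cite: MochizukiSemiAnbd2006, Thm 5.4 (iii), p. 66] -/
theorem arithQuasiGeometricCorrespondenceStatementCompat_outerModel
    [Finite 𝒢.graph.Vertex] [Finite 𝒢.graph.Edge] [Finite ℋ.graph.Vertex] [Finite ℋ.graph.Edge]
    (h𝒢 : Cor39Hypotheses 𝒢) (hℋ : Cor39Hypotheses ℋ) (R𝒢 : ChartRepresentatives c𝒢) (Rℋ : ChartRepresentatives cℋ)
    -- the two outer models: outer actions over base actions, `ℍ′`'s over ITS OWN `Π_{A′}`
    (ρ𝒢 : 𝔊.PA →* TopOut c𝒢.G) (baseAct𝒢 : 𝔊.PA →* Aut 𝒢.graph)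
    (ρℋ : ℍ.PA →* TopOut cℋ.G) (baseActℋ : ℍ.PA →* Aut ℋ.graph)
    -- their topologies (abc-iut-w6-d070's `arithLevelTopology` package; pinned in v2)
    [TopologicalSpace (outerSemidirectProduct ρ𝒢)] [TopologicalSpace (outerSemidirectProduct ρℋ)]
    [IsTopologicalGroup (outerSemidirectProduct ρℋ)] [T2Space (outerSemidirectProduct ρℋ)]
    (hι𝒢c : Continuous (toOuterSemidirectProduct ρ𝒢)) (hιℋe : IsEmbedding (toOuterSemidirectProduct ρℋ))
    (haugH : Continuous (outerSemidirectProductSnd ρℋ))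
    -- the arithmetic `B^temp` (design binder of the umbrella)
    (btemp : (φ : ArithHom 𝓥 𝔊 ℍ) → φ.IsLocallyOpen → ArithHom.IsOverA 𝔊 ℍ e φ →
      (outerSemidirectProduct ρ𝒢 →* outerSemidirectProduct ρℋ))
    (hcont : ∀ (φ : ArithHom 𝓥 𝔊 ℍ) (h₁ : φ.IsLocallyOpen) (h₂ : ArithHom.IsOverA 𝔊 ℍ e φ),
      Continuous (btemp φ h₁ h₂))
    (hover : ∀ (φ : ArithHom 𝓥 𝔊 ℍ) (h₁ : φ.IsLocallyOpen) (h₂ : ArithHom.IsOverA 𝔊 ℍ e φ),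
      (e.symm.toMonoidHom.comp (outerSemidirectProductSnd ρℋ)).comp (btemp φ h₁ h₂) = outerSemidirectProductSnd ρ𝒢)
    -- Def 5.1 (i) DESIGN data of the two outer models (Prop 3.6 (iv) at `ρ(a)` incl. the branch-PAIR form,
    -- Def 5.1 (i)(c)) and Thm 5.4's printed frame «no switching of branches»
    (hV : ∀ (a : 𝔊.PA) (v : 𝒢.graph.Vertex) (H : Subgroup c𝒢.G), H ∈ verticialSubgroups c𝒢 v →
      ∃ φ : contMulAut c𝒢.G, TopOut.mk c𝒢.G φ = ρ𝒢 a ∧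
        H.map (φ : MulAut c𝒢.G).toMonoidHom ∈ verticialSubgroups c𝒢 ((baseAct𝒢 a).hom.vertexMap v))
    (hE : ∀ (a : 𝔊.PA) (x : 𝒢.graph.Edge) (K : Subgroup c𝒢.G), K ∈ edgeLikeSubgroups c𝒢 x →
      ∃ φ : contMulAut c𝒢.G, TopOut.mk c𝒢.G φ = ρ𝒢 a ∧
        K.map (φ : MulAut c𝒢.G).toMonoidHom ∈ edgeLikeSubgroups c𝒢 ((baseAct𝒢 a).hom.edgeMap x))
    (hopen : ∃ U : Subgroup 𝔊.PA, IsOpen (U : Set 𝔊.PA) ∧ ∀ a ∈ U,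
      (∀ v, (baseAct𝒢 a).hom.vertexMap v = v) ∧ (∀ x, (baseAct𝒢 a).hom.edgeMap x = x) ∧
        ∀ b, (baseAct𝒢 a).hom.branchMap b = b)
    (hBR : ∀ (a : 𝔊.PA) (b : 𝒢.graph.Branch) (v : 𝒢.graph.Vertex) (hb : 𝒢.graph.abuts b = some v)
      (φ : 𝒢.Gv v →ₜ* c𝒢.G), IsVerticialHom c𝒢 v φ →
      ∃ Φ : contMulAut c𝒢.G, TopOut.mk c𝒢.G Φ = ρ𝒢 a ∧
        ∃ φ' : 𝒢.Gv ((baseAct𝒢 a).hom.vertexMap v) →ₜ* c𝒢.G,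
          IsVerticialHom c𝒢 ((baseAct𝒢 a).hom.vertexMap v) φ' ∧ ∃ x' : c𝒢.G,
            Subgroup.map (Φ : MulAut c𝒢.G).toMonoidHom φ.toMonoidHom.range =
              Subgroup.map (MulAut.conj x').toMonoidHom φ'.toMonoidHom.range ∧
            Subgroup.map (Φ : MulAut c𝒢.G).toMonoidHom
                (Subgroup.map φ.toMonoidHom (𝒢.branchSubgroup b v hb)) =
              Subgroup.map (MulAut.conj x').toMonoidHom
                (Subgroup.map φ'.toMonoidHom
                  (𝒢.branchSubgroup ((baseAct𝒢 a).hom.branchMap b) ((baseAct𝒢 a).hom.vertexMap v)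
                    ((baseAct𝒢 a).hom.abuts_branchMap b v hb))))
    (noSwitchBase : NoBranchSwitching 𝒢.graph.edgeOf
      (fun (a : 𝔊.PA) (b : 𝒢.graph.Branch) => (baseAct𝒢 a).hom.branchMap b))
    (hV' : ∀ (a : ℍ.PA) (v : ℋ.graph.Vertex) (H : Subgroup cℋ.G), H ∈ verticialSubgroups cℋ v →
      ∃ φ : contMulAut cℋ.G, TopOut.mk cℋ.G φ = ρℋ a ∧
        H.map (φ : MulAut cℋ.G).toMonoidHom ∈ verticialSubgroups cℋ ((baseActℋ a).hom.vertexMap v))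
    (hE' : ∀ (a : ℍ.PA) (x : ℋ.graph.Edge) (K : Subgroup cℋ.G), K ∈ edgeLikeSubgroups cℋ x →
      ∃ φ : contMulAut cℋ.G, TopOut.mk cℋ.G φ = ρℋ a ∧
        K.map (φ : MulAut cℋ.G).toMonoidHom ∈ edgeLikeSubgroups cℋ ((baseActℋ a).hom.edgeMap x))
    (hopen' : ∃ U : Subgroup ℍ.PA, IsOpen (U : Set ℍ.PA) ∧ ∀ a ∈ U,
      (∀ v, (baseActℋ a).hom.vertexMap v = v) ∧ (∀ x, (baseActℋ a).hom.edgeMap x = x) ∧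
        ∀ b, (baseActℋ a).hom.branchMap b = b)
    (hBR' : ∀ (a : ℍ.PA) (b : ℋ.graph.Branch) (v : ℋ.graph.Vertex) (hb : ℋ.graph.abuts b = some v)
      (φ : ℋ.Gv v →ₜ* cℋ.G), IsVerticialHom cℋ v φ →
      ∃ Φ : contMulAut cℋ.G, TopOut.mk cℋ.G Φ = ρℋ a ∧
        ∃ φ' : ℋ.Gv ((baseActℋ a).hom.vertexMap v) →ₜ* cℋ.G,
          IsVerticialHom cℋ ((baseActℋ a).hom.vertexMap v) φ' ∧ ∃ x' : cℋ.G,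
            Subgroup.map (Φ : MulAut cℋ.G).toMonoidHom φ.toMonoidHom.range =
              Subgroup.map (MulAut.conj x').toMonoidHom φ'.toMonoidHom.range ∧
            Subgroup.map (Φ : MulAut cℋ.G).toMonoidHom
                (Subgroup.map φ.toMonoidHom (ℋ.branchSubgroup b v hb)) =
              Subgroup.map (MulAut.conj x').toMonoidHom
                (Subgroup.map φ'.toMonoidHom
                  (ℋ.branchSubgroup ((baseActℋ a).hom.branchMap b) ((baseActℋ a).hom.vertexMap v)
                    ((baseActℋ a).hom.abuts_branchMap b v hb))))
    (noSwitchBase' : NoBranchSwitching ℋ.graph.edgeOf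
      (fun (a : ℍ.PA) (b : ℋ.graph.Branch) => (baseActℋ a).hom.branchMap b))
    -- Thm 5.4 (ii) and Rmk 5.3.1 at the two outer models, NATIVELY over `Π_A` resp. `Π_{A′}`
    (hIIG : ArithMaximalCompactStatementII (decompositionDataOfChart R𝒢 (toOuterSemidirectProduct ρ𝒢))
      (outerSemidirectProductSnd ρ𝒢))
    (hIIH : ArithMaximalCompactStatementII (decompositionDataOfChart Rℋ (toOuterSemidirectProduct ρℋ))
      (outerSemidirectProductSnd ρℋ))
    (hRG : VerticialEdgeLikeCompactAmpleStatement (decompositionDataOfChart R𝒢 (toOuterSemidirectProduct ρ𝒢))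
      (outerSemidirectProductSnd ρ𝒢))
    (hRH : VerticialEdgeLikeCompactAmpleStatement (decompositionDataOfChart Rℋ (toOuterSemidirectProduct ρℋ))
      (outerSemidirectProductSnd ρℋ))
    -- (D1)/(D2): the dictionary of arrows with chosen 2-cells and its chart-level representatives (verbatim)
    (dict : (𝔊.G ⟶ ℍ.G) → Hom 𝒢 ℋ) (θd : ∀ g, (dict g).ConjugatorFamily) (hlo : ∀ g, (dict g).IsLocallyOpen)
    (φc : (𝔊.G ⟶ ℍ.G) → (c𝒢.G →ₜ* cℋ.G))
    (hφc : ∀ g, Nonempty ((dict g).chartPullbackWith (θd g) c𝒢 cℋ ≅ BTemp.res (φc g)))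
    (hfaith : ∀ g₁ g₂ : 𝔊.G ⟶ ℍ.G, Nonempty ((dict g₁).chartPullbackWith (θd g₁) c𝒢 cℋ ≅
      (dict g₂).chartPullbackWith (θd g₂) c𝒢 cℋ) → g₁ = g₂)
    (hfull : ∀ F : Hom 𝒢 ℋ, F.IsLocallyOpen → ∀ θ : F.ConjugatorFamily,
      ∃ g : 𝔊.G ⟶ ℍ.G, Nonempty ((dict g).chartPullbackWith (θd g) c𝒢 cℋ ≅ F.chartPullbackWith θ c𝒢 cℋ))
    -- (D1a)/(D1b): the graph actions of `Π_A` on `𝔾` and of `Π_{A′}` on `ℍ′` with chosen 2-cells, REPRESENTED at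
    -- the outer actions (abc-iut-w5-d141's `hrep` currency), and the functoriality of the dictionary
    (F𝒢 : 𝔊.PA → Hom 𝒢 𝒢) (θ𝒢 : ∀ a, (F𝒢 a).ConjugatorFamily)
    (hrep𝒢 : ∀ a, ∃ (Φ : contMulAut c𝒢.G) (φ : c𝒢.G →ₜ* c𝒢.G), TopOut.mk c𝒢.G Φ = ρ𝒢 a ∧
      (∀ t, (Φ : MulAut c𝒢.G) t = φ t) ∧ Nonempty ((F𝒢 a).chartPullbackWith (θ𝒢 a) c𝒢 c𝒢 ≅ BTemp.res φ))
    (hpre : ∀ (a : 𝔊.PA) (g : 𝔊.G ⟶ ℍ.G),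
      Nonempty ((dict ((𝔊.ρ a).hom ≫ g)).chartPullbackWith (θd ((𝔊.ρ a).hom ≫ g)) c𝒢 cℋ ≅
        (dict g).chartPullbackWith (θd g) c𝒢 cℋ ⋙ (F𝒢 a).chartPullbackWith (θ𝒢 a) c𝒢 c𝒢))
    (Fℋ : ℍ.PA → Hom ℋ ℋ) (θℋ : ∀ a, (Fℋ a).ConjugatorFamily)
    (hrepℋ : ∀ a, ∃ (Φ : contMulAut cℋ.G) (φ : cℋ.G →ₜ* cℋ.G), TopOut.mk cℋ.G Φ = ρℋ a ∧
      (∀ t, (Φ : MulAut cℋ.G) t = φ t) ∧ Nonempty ((Fℋ a).chartPullbackWith (θℋ a) cℋ cℋ ≅ BTemp.res φ))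
    (hpost : ∀ (a : ℍ.PA) (g : 𝔊.G ⟶ ℍ.G),
      Nonempty ((dict (g ≫ (ℍ.ρ a).hom)).chartPullbackWith (θd (g ≫ (ℍ.ρ a).hom)) c𝒢 cℋ ≅
        (Fℋ a).chartPullbackWith (θℋ a) cℋ cℋ ⋙ (dict g).chartPullbackWith (θd g) c𝒢 cℋ))
    -- the arithmetic `B^temp` on the geometric part, chart currency (verbatim, kernel of `aug_ℍ` natively)
    (hbtempφ : ∀ (φ : ArithHom 𝓥 𝔊 ℍ) (h₁ : φ.IsLocallyOpen) (h₂ : ArithHom.IsOverA 𝔊 ℍ e φ),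
      ∃ δ ∈ (outerSemidirectProductSnd ρℋ).ker,
        ∀ y : c𝒢.G, btemp φ h₁ h₂ (toOuterSemidirectProduct ρ𝒢 y) =
          δ * toOuterSemidirectProduct ρℋ (φc φ.geom y) * δ⁻¹)
    (he : Continuous e) :
    Literature.AnabelianGeometry.SemiGraphs.ArithQuasiGeometricCorrespondenceStatementCompat 𝔊 ℍ e
      (outerSemidirectProductSnd ρ𝒢) (outerSemidirectProductSnd ρℋ) btemp := by
  -- Prop 5.2 (iv): exactness of `1 → π₁^temp → E → Π_A → 1` at both outer models (temp-slimness)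
  obtain ⟨hι𝒢, hex𝒢, hsurj𝒢⟩ := outerAction_exact c𝒢 ρ𝒢 h𝒢.toProp36Hypotheses
  obtain ⟨hιℋ, hexℋ, -⟩ := outerAction_exact cℋ ρℋ hℋ.toProp36Hypotheses
  -- `e` is an isomorphism of PROFINITE groups: its inverse is continuous too
  have he' : Continuous e.symm := he.continuous_symm_of_equiv_compact_to_t2 (f := e.toEquiv)
  have he'' : Continuous e.symm.symm := he
  -- the kernel of `e⁻¹ ∘ aug_ℍ` is the kernel of `aug_ℍ`
  have hker : (e.symm.toMonoidHom.comp (outerSemidirectProductSnd ρℋ)).ker = (outerSemidirectProductSnd ρℋ).ker := by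
    ext x
    simp only [MonoidHom.mem_ker, MonoidHom.coe_comp, Function.comp_apply, MulEquiv.coe_toMonoidHom,
      MulEquiv.map_eq_one_iff]
  have hexℋ' : (toOuterSemidirectProduct ρℋ).range = (e.symm.toMonoidHom.comp (outerSemidirectProductSnd ρℋ)).ker := by
    rw [hker]; exact hexℋ
  -- Thm 3.7 (iii) at the two finite graphs
  have h𝒢iii : CompactInVerticialAt 𝒢 := compactInVerticialAt_of_finiteGraph' inferInstance inferInstance
  have hℋiii : CompactInVerticialAt ℋ := compactInVerticialAt_of_finiteGraph' inferInstance inferInstance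
  -- Def 5.1 (i) on the charts: the two `ArithChartAction`s, `ℍ′`'s transported along `e`
  have A𝒢 := arithChartAction_outerAction c𝒢 ρ𝒢 baseAct𝒢 hV hE hopen
  have Aℋ := (arithChartAction_outerAction cℋ ρℋ baseActℋ hV' hE' hopen').comp_mulEquiv e.symm he''
  -- Thm 5.4 (ii) / Rmk 5.3.1 at `ℍ′`, transported along `e`
  have hIIH' := (arithMaximalCompactStatementII_comp_mulEquiv_iff e.symm he' he''
    (decompositionDataOfChart Rℋ (toOuterSemidirectProduct ρℋ)) (outerSemidirectProductSnd ρℋ)).mpr hIIH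
  have hRH' := (verticialEdgeLikeCompactAmpleStatement_comp_mulEquiv_iff e.symm he' he''
    (decompositionDataOfChart Rℋ (toOuterSemidirectProduct ρℋ)) (outerSemidirectProductSnd ρℋ)).mpr hRH
  -- `hact` at the two outer models (abc-iut-w5-d141)
  have hact𝒢 := hact_outerSemidirectProduct c𝒢 ρ𝒢 F𝒢 θ𝒢 hrep𝒢
  have hactℋ : ∀ η : outerSemidirectProduct ρℋ, ∃ cη : cℋ.G →ₜ* cℋ.G,
      (∀ z, toOuterSemidirectProduct ρℋ (cη z) = η * toOuterSemidirectProduct ρℋ z * η⁻¹) ∧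
      Nonempty (((fun a => Fℋ (e a)) ((e.symm.toMonoidHom.comp (outerSemidirectProductSnd ρℋ)) η)).chartPullbackWith
        ((fun a => θℋ (e a)) ((e.symm.toMonoidHom.comp (outerSemidirectProductSnd ρℋ)) η)) cℋ cℋ ≅ BTemp.res cη) := by
    intro η
    obtain ⟨cη, h1, h2⟩ := hact_outerSemidirectProduct cℋ ρℋ Fℋ θℋ hrepℋ η
    refine ⟨cη, h1, ?_⟩
    have hx : e ((e.symm.toMonoidHom.comp (outerSemidirectProductSnd ρℋ)) η) = outerSemidirectProductSnd ρℋ η := by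
      simp only [MonoidHom.coe_comp, Function.comp_apply, MulEquiv.coe_toMonoidHom, MulEquiv.apply_symm_apply]
    have key : ∀ a : ℍ.PA, a = outerSemidirectProductSnd ρℋ η →
        Nonempty ((Fℋ a).chartPullbackWith (θℋ a) cℋ cℋ ≅ BTemp.res cη) := by
      rintro a rfl; exact h2
    exact key _ hx
  -- the kernel-currency of `hbtempφ` and `hcommB'`
  have hbtempφ' : ∀ (φ : ArithHom 𝓥 𝔊 ℍ) (h₁ : φ.IsLocallyOpen) (h₂ : ArithHom.IsOverA 𝔊 ℍ e φ),
      ∃ δ ∈ (e.symm.toMonoidHom.comp (outerSemidirectProductSnd ρℋ)).ker,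
        ∀ y : c𝒢.G, btemp φ h₁ h₂ (toOuterSemidirectProduct ρ𝒢 y) =
          δ * toOuterSemidirectProduct ρℋ (φc φ.geom y) * δ⁻¹ := by
    intro φ h₁ h₂; rw [hker]; exact hbtempφ φ h₁ h₂
  -- the branch commensurators of p. 65 (abc-iut-w4-d029 / abc-iut-w4-d064 `hcommB_At` over abc-iut-w4-d082's
  -- branch-granular chart action), `ℍ′`'s read in the kernel currency of `e⁻¹ ∘ aug_ℍ`
  have hcommB := fun b => (arithChartBranchAction_outerAction c𝒢 ρ𝒢 baseAct𝒢 hV hE hopen hBR).hcommB_At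
    h𝒢iii h𝒢.thm37Hypotheses h𝒢.isGraph R𝒢 hι𝒢 hex𝒢 noSwitchBase b
  have hcommB'' : ∀ b' : ℋ.graph.Branch, Subgroup.Commensurable.commensurator
      ((decompositionDataOfChart Rℋ (toOuterSemidirectProduct ρℋ)).brGp b' ⊓
        (e.symm.toMonoidHom.comp (outerSemidirectProductSnd ρℋ)).ker) =
        (decompositionDataOfChart Rℋ (toOuterSemidirectProduct ρℋ)).brGp b' := by
    intro b'; rw [hker]
    exact (arithChartBranchAction_outerAction cℋ ρℋ baseActℋ hV' hE' hopen' hBR').hcommB_At hℋiii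
      hℋ.thm37Hypotheses hℋ.isGraph Rℋ hιℋ hexℋ noSwitchBase' b'
  exact arithQuasiGeometricCorrespondenceStatementCompat_ofChartDict (outerSemidirectProductSnd ρ𝒢)
    (outerSemidirectProductSnd ρℋ) btemp h𝒢iii hℋiii h𝒢 hℋ R𝒢 Rℋ (toOuterSemidirectProduct ρ𝒢) hι𝒢 hι𝒢c
    (toOuterSemidirectProduct ρℋ) hιℋ hιℋe hex𝒢 hexℋ' A𝒢 Aℋ hIIG hIIH' hRG hRH' (he'.comp haugH) hcont hover
    dict θd hlo φc hφc hfaith hfull F𝒢 θ𝒢 hact𝒢 hpre (fun a => Fℋ (e a)) (fun a => θℋ (e a)) hactℋ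
    (fun a g => hpost (e a) g) hbtempφ' hcommB hcommB'' hsurj𝒢 he

end Literature.AnabelianGeometry.SemiGraphs
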